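import Literature.MathematicalPhysics.StatisticalMechanics.GridEdgeIsoperimetry
import HarnessLib

/-!
# Slab-deficient cubes are edge-isoperimetric minimizers in every dimension
# (Mainini–Schmidt 2020, Lemma 3.4–3.5, Theorem 1.1 (ii)) — discharge of `MaininiSchmidt2020_lemma35`
# and `MaininiSchmidt2020_thm11_lower`

Topic `Literature/MathematicalPhysics/StatisticalMechanics`; continues `GridEdgeIsoperimetry.lean`
(`EIP^d = cubicleCost d`, nested solutions in every `ℤ^d`).  Everything here is PROVED; no named
facts are introduced, and the vendored fact `EdgeIsoperimetricFluctuations.MaininiSchmidt2020_lemma35`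
([MS20] Lemma 3.5: for `d ≥ 2`, `ℓ ≥ 1`, `1 ≤ p ≤ ⌊h_{ℓ,d}⌋ = ⌊ℓ^{2^{1−d}}⌋` the slab-deficient cube
`P_{ℓ,d,p} = {1,…,ℓ−p} × {1,…,ℓ}^{d−1}` is an `EIP^d` minimizer — the lower-bound construction behind
[MS20] Theorem 1.1 (ii)) is DISCHARGED (`MaininiSchmidt2020_lemma35_holds`), and with it [MS20] Theorem 1.1 (ii) — the
SHARPNESS of the `n^{(d−1+2^{1−d})/d}` fluctuation law in every dimension `d ≥ 2`, the vendored fact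
`EdgeIsoperimetricFluctuations.MaininiSchmidt2020_thm11_lower` — is DISCHARGED as well
(`MaininiSchmidt2020_thm11_lower_holds`, constant `K_d = 1/(2d)`); the instances `d = 2, 3` of both
were already theorems (`MaininiSchmidt2020_lemma35_two/_three`, `MaininiSchmidt2020_thm11_lower_two/_three`).

* Section `Slab`: the sets `slabConfig d ℓ p` in every dimension — membership, slices across the
  short axis (cubes `{1,…,ℓ}^{n} = slabConfig n ℓ 0`), cardinality `(ℓ−p)ℓ^{d−1}`, and the perimeter
  `#Θ_d(P_{ℓ,d,p}) = 2(ℓ^{d−1} + (d−1)(ℓ−p)ℓ^{d−2})` (`card_boundaryPairs_slabConfig`, by the slice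
  decomposition of `EIPMinimizerSections.lean`; cubes: `card_boundaryPairs_slabConfig_zero`).
* Section `SlabValue`: the printed induction on `d` in VALUE form (`eipValue_slab`:
  `EIP^d(#P_{ℓ,d,p}) = #Θ_d(P_{ℓ,d,p})`).  [MS20]'s daisies are replaced by the cubicles of
  `GridEdgeIsoperimetry.lean`: Lemma 3.4 becomes `eipValue_add_mul_le` (insert `p` slices of size `s`
  into the optimal sorted stack of `N` when its largest slice has `≥ s` points:
  `EIP^{n+1}(N + ps) ≤ EIP^{n+1}(N) + p·EIP^n(s)`), the rearrangement `M_{ℓ,d,p} ↦ Q_{ℓ,d,p}` becomes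
  the pseudo-cubic representation `(ℓ²−p²)ℓ^{d−2} = [ℓ−1,d−1]^d + (ℓ−p²)ℓ^{d−2}`
  (`cubicleCost_box_layer`), and the exponent bookkeeping `p² ≤ ⌊h_{ℓ,d}⌋² ≤ ⌊h_{ℓ,d−1}⌋`,
  `p² < ℓ` is `sq_le_floor_h`, `sq_lt_of_le_floor_h`, `floor_h_succ_le`; the base `d = 2` is
  `SquareLatticeEdgeIsoperimetry.MaininiSchmidt2020_lemma35_two`.  Then
  `isEIPMinimizer_slabConfig` and `MaininiSchmidt2020_lemma35_holds`.
* Section `Fluctuation`: [MS20] Theorem 1.1 (ii) ("This follows directly from Lemma 3.5") with the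
  slabs `P_{ℓ,d,u}`, `ℓ = u^{2^{d−1}}`, for which `h_{ℓ,d} = u` and `(ℓ^d)^{(d−1+2^{1−d})/d} = ℓ^{d−1}u`
  hold exactly (`rpow_h_of_pow`, `rpow_maximalFluctuationExponent_pow`); every translate of the Wulff
  cube `W_N` (`N = #P`) meets `P` in at most `(ℓ−u)m^{d−1}` points (`card_image_sub_inter_wulffCube_le`)
  and has side `m ≤ ℓ − u/d` (`latticeRootFloor_slab_le`, Bernoulli), whence
  `#((P − a) △ W_N) ≥ uℓ^{d−1}/(2d) ≥ N^{(d−1+2^{1−d})/d}/(2d)` (`slab_deviation_lower`) and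
  `MaininiSchmidt2020_thm11_lower_holds`.

## References

* [MS20] E. Mainini, B. Schmidt, *Maximal fluctuations around the Wulff shape for edge-isoperimetric
  sets in ℤ^d: a sharp scaling law*, arXiv:2003.01679 (2020), Theorem 1.1 (ii), Definition 3.1,
  Proposition 3.2, Lemma 3.4, Lemma 3.5.  Bib key `MaininiSchmidt2020`.
* [AL13] G. Agnarsson, K. Lauria, *Extremal subgraphs of the d-dimensional grid graph*,
  arXiv:1302.6517 (2013), §5 (pseudo-cubic representations).  Bib key `AgnarssonLauria2013`.
-/

namespace Literature.MathematicalPhysics.StatisticalMechanics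

open Finset
open Literature.Probability.LatticeModels

/-! ### The slab-deficient cubes `P_{ℓ,d,p}` in every dimension: slices, cardinality, perimeter -/

section Slab

variable {n : ℕ}

/-- Membership in `P_{ℓ,d,p} = {1,…,ℓ−p} × {1,…,ℓ}^{d−1}`. [cite: MaininiSchmidt2020, Lemma 3.5 (P_{ℓ,d,p})] -/
theorem mem_slabConfig {d ℓ p : ℕ} {z : Site d} :
    z ∈ slabConfig d ℓ p ↔
      ∀ i : Fin d, 1 ≤ z i ∧ z i ≤ if (i : ℕ) = 0 then (ℓ : ℤ) - p else (ℓ : ℤ) := by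
  unfold slabConfig
  rw [Fintype.mem_piFinset]
  refine forall_congr' fun i => ?_
  split_ifs <;> exact mem_Icc

/-- Membership in the cube `{1,…,ℓ}^n = slabConfig n ℓ 0`. [cite: MaininiSchmidt2020, §1 (W_n)] -/
theorem mem_slabConfig_zero {ℓ : ℕ} {y : Site n} :
    y ∈ slabConfig n ℓ 0 ↔ ∀ j : Fin n, 1 ≤ y j ∧ y j ≤ ℓ := by
  rw [mem_slabConfig]
  refine forall_congr' fun j => ?_
  simp

/-- The slices of `P_{ℓ,n+1,p}` across the short axis are cubes `{1,…,ℓ}^n` at heights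
`1,…,ℓ−p` and empty elsewhere. [cite: MaininiSchmidt2020, Lemma 3.5 (P_{ℓ,d,p})] -/
theorem sliceAt_slabConfig_succ (ℓ p : ℕ) (t : ℤ) :
    sliceAt (slabConfig (n + 1) ℓ p) t =
      if 1 ≤ t ∧ t ≤ (ℓ : ℤ) - p then slabConfig n ℓ 0 else ∅ := by
  ext y
  rw [mem_sliceAt, mem_slabConfig, Fin.forall_fin_succ]
  simp only [Fin.cons_zero, Fin.cons_succ, Fin.val_zero, Fin.val_succ, if_true,
    Nat.add_one_ne_zero, if_false]
  split_ifs with ht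
  · rw [mem_slabConfig_zero]
    exact ⟨fun h => h.2, fun h => ⟨ht, h⟩⟩
  · simp only [notMem_empty, iff_false, not_and]
    exact fun h _ => ht h

/-- `#{1,…,ℓ}^n = ℓ^n`. [cite: MaininiSchmidt2020, §1 (W_n)] -/
theorem card_slabConfig_zero (n ℓ : ℕ) : #(slabConfig n ℓ 0) = ℓ ^ n := by
  unfold slabConfig
  rw [Fintype.card_piFinset]
  have h : ∀ i : Fin n, #(if (i : ℕ) = 0 then Finset.Icc (1 : ℤ) ((ℓ : ℤ) - ((0 : ℕ) : ℤ))
      else Finset.Icc (1 : ℤ) ℓ) = ℓ := by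
    intro i
    split_ifs <;> simp
  rw [prod_congr rfl fun i _ => h i, prod_const, card_univ, Fintype.card_fin]

/-- `#P_{ℓ,n+1,p} = (ℓ − p) ℓ^n`. [cite: MaininiSchmidt2020, Lemma 3.5 (P_{ℓ,d,p})] -/
theorem card_slabConfig_succ (n ℓ p : ℕ) : #(slabConfig (n + 1) ℓ p) = (ℓ - p) * ℓ ^ n := by
  unfold slabConfig
  rw [Fintype.card_piFinset, Fin.prod_univ_succ]
  have h : ∀ j : Fin n, #(if ((j.succ : Fin (n + 1)) : ℕ) = 0 then
      Finset.Icc (1 : ℤ) ((ℓ : ℤ) - p) else Finset.Icc (1 : ℤ) ℓ) = ℓ := by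
    intro j
    rw [if_neg (by rw [Fin.val_succ]; exact Nat.add_one_ne_zero _)]
    simp
  rw [prod_congr rfl fun j _ => h j, prod_const, card_univ, Fintype.card_fin]
  simp only [Fin.val_zero, if_true, Int.card_Icc]
  congr 1
  omega

/-- The occupied heights of `P_{ℓ,n+1,p}` across the short axis are `1,…,ℓ−p` (`ℓ ≥ 1`).
[cite: MaininiSchmidt2020, Lemma 3.5 (P_{ℓ,d,p})] -/
theorem firstCoords_slabConfig_succ {ℓ : ℕ} (hℓ : 1 ≤ ℓ) (p : ℕ) :
    firstCoords (slabConfig (n + 1) ℓ p) = Finset.Icc (1 : ℤ) ((ℓ : ℤ) - p) := by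
  ext t
  rw [firstCoords, mem_image, mem_Icc]
  constructor
  · rintro ⟨x, hx, rfl⟩
    have h := (mem_slabConfig.1 hx) 0
    simpa using h
  · intro ht
    refine ⟨Fin.cons t (fun _ => 1), ?_, by simp⟩
    rw [mem_slabConfig, Fin.forall_fin_succ]
    refine ⟨by simpa using ht, fun j => ?_⟩
    simp only [Fin.cons_succ, Fin.val_succ, Nat.add_one_ne_zero, if_false]
    exact ⟨le_rfl, by exact_mod_cast hℓ⟩

/-- In dimension `0` there are no boundary pairs. [folklore] -/
private theorem card_boundaryPairs_site_zero (A : Finset (Site 0)) : #(boundaryPairs A) = 0 := by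
  rw [card_eq_zero, boundaryPairs, (univ_eq_empty : (univ : Finset (Fin 0 × Bool)) = ∅),
    product_empty, filter_empty]

/-- **Perimeter recursion for slabs**: `#Θ_{n+1}(P_{ℓ,n+1,p}) = 2ℓ^n + (ℓ−p)·#Θ_n({1,…,ℓ}^n)`
(`p < ℓ`): the `ℓ − p` cube slices plus the two end faces.
[cite: MaininiSchmidt2020, Lemma 3.5 (Θ_d(P_{ℓ,d,p})); Proposition 3.2 (slice decomposition)] -/
theorem card_boundaryPairs_slabConfig_succ {ℓ p : ℕ} (hp : p < ℓ) :
    #(boundaryPairs (slabConfig (n + 1) ℓ p)) =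
      2 * ℓ ^ n + (ℓ - p) * #(boundaryPairs (slabConfig n ℓ 0)) := by
  have hℓ : 1 ≤ ℓ := by omega
  rw [card_boundaryPairs_eq_sum_sliceAt_add (slabConfig (n + 1) ℓ p),
    card_vertBoundaryPairs_eq_sum (slabConfig (n + 1) ℓ p),
    card_vertBoundaryPairs_eq_sum (slabConfig (n + 1) ℓ p), firstCoords_slabConfig_succ hℓ p]
  simp only [if_true, Bool.false_eq_true, if_false]
  have hs : ∀ t ∈ Finset.Icc (1 : ℤ) ((ℓ : ℤ) - p),
      sliceAt (slabConfig (n + 1) ℓ p) t = slabConfig n ℓ 0 := fun t ht => by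
    rw [sliceAt_slabConfig_succ, if_pos (mem_Icc.1 ht)]
  have h1 : ∑ t ∈ Finset.Icc (1 : ℤ) ((ℓ : ℤ) - p),
      #(boundaryPairs (sliceAt (slabConfig (n + 1) ℓ p) t)) =
        (ℓ - p) * #(boundaryPairs (slabConfig n ℓ 0)) := by
    rw [sum_congr rfl fun t ht => by rw [hs t ht], sum_const, Int.card_Icc, smul_eq_mul]
    congr 1
    omega
  have h2 : ∑ t ∈ Finset.Icc (1 : ℤ) ((ℓ : ℤ) - p),
      #(sliceAt (slabConfig (n + 1) ℓ p) t \ sliceAt (slabConfig (n + 1) ℓ p) (t + 1)) = ℓ ^ n := by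
    have : ∀ t ∈ Finset.Icc (1 : ℤ) ((ℓ : ℤ) - p),
        #(sliceAt (slabConfig (n + 1) ℓ p) t \ sliceAt (slabConfig (n + 1) ℓ p) (t + 1)) =
          if t = (ℓ : ℤ) - p then ℓ ^ n else 0 := by
      intro t ht
      rw [mem_Icc] at ht
      rw [hs t (mem_Icc.2 ht), sliceAt_slabConfig_succ]
      split_ifs with h' h''
      · exfalso; omega
      · simp
      · rw [sdiff_empty, card_slabConfig_zero]
      · exfalso; omega
    rw [sum_congr rfl this, sum_ite_eq', if_pos (mem_Icc.2 ⟨by omega, le_rfl⟩)]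
  have h3 : ∑ t ∈ Finset.Icc (1 : ℤ) ((ℓ : ℤ) - p),
      #(sliceAt (slabConfig (n + 1) ℓ p) t \ sliceAt (slabConfig (n + 1) ℓ p) (t + -1)) =
        ℓ ^ n := by
    have : ∀ t ∈ Finset.Icc (1 : ℤ) ((ℓ : ℤ) - p),
        #(sliceAt (slabConfig (n + 1) ℓ p) t \ sliceAt (slabConfig (n + 1) ℓ p) (t + -1)) =
          if t = 1 then ℓ ^ n else 0 := by
      intro t ht
      rw [mem_Icc] at ht
      rw [hs t (mem_Icc.2 ht), sliceAt_slabConfig_succ]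
      split_ifs with h' h''
      · exfalso; omega
      · simp
      · rw [sdiff_empty, card_slabConfig_zero]
      · exfalso; omega
    rw [sum_congr rfl this, sum_ite_eq', if_pos (mem_Icc.2 ⟨le_rfl, by omega⟩)]
  rw [h1, h2, h3]
  ring

/-- **The perimeter of the cube** `{1,…,ℓ}^n`: `#Θ_n = 2nℓ^{n−1}` (`ℓ ≥ 1`).
[cite: MaininiSchmidt2020, §1 (Θ_d(W_n)); AgnarssonLauria2013, Proposition 3.2] -/
theorem card_boundaryPairs_slabConfig_zero {ℓ : ℕ} (hℓ : 1 ≤ ℓ) (n : ℕ) :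
    #(boundaryPairs (slabConfig n ℓ 0)) = 2 * (n * ℓ ^ (n - 1)) := by
  induction n with
  | zero => simp [card_boundaryPairs_site_zero]
  | succ n ih =>
    rw [card_boundaryPairs_slabConfig_succ (by omega), ih, Nat.sub_zero, Nat.add_sub_cancel]
    rcases n with _ | n
    · simp
    · rw [Nat.add_sub_cancel]
      ring

/-- **The perimeter of `P_{ℓ,n+1,p}`**: `#Θ_{n+1}(P_{ℓ,n+1,p}) = 2(ℓ^n + n(ℓ−p)ℓ^{n−1})` (`p < ℓ`).
[cite: MaininiSchmidt2020, Lemma 3.5 (Θ_d(P_{ℓ,d,p}))] -/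
theorem card_boundaryPairs_slabConfig {ℓ p : ℕ} (hp : p < ℓ) (n : ℕ) :
    #(boundaryPairs (slabConfig (n + 1) ℓ p)) = 2 * (ℓ ^ n + n * ((ℓ - p) * ℓ ^ (n - 1))) := by
  rw [card_boundaryPairs_slabConfig_succ hp, card_boundaryPairs_slabConfig_zero (by omega)]
  ring

/-- `P_{ℓ,n+1,p}` is empty when `ℓ ≤ p`. [cite: MaininiSchmidt2020, Lemma 3.5 (P_{ℓ,d,p})] -/
theorem slabConfig_succ_eq_empty {ℓ p : ℕ} (h : ℓ ≤ p) (n : ℕ) : slabConfig (n + 1) ℓ p = ∅ := by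
  rw [← card_eq_zero, card_slabConfig_succ, Nat.sub_eq_zero_of_le h, zero_mul]

end Slab
/-! ### [MS20] Lemma 3.5 in every dimension `d ≥ 2`: the slab-deficient cubes are minimizers -/

section SlabValue

variable {n : ℕ}

/-- `EIP^{k+1}(m^{k+1}) = 2(k+1)m^k` (`m ≥ 1`): cubes. [cite: AgnarssonLauria2013, Proposition 3.2 (d-th powers)] -/
theorem eipValue_pow_succ (k : ℕ) {m : ℕ} (hm : 1 ≤ m) :
    eipValue (k + 1) (m ^ (k + 1)) = 2 * ((k + 1) * m ^ k) := by
  rw [eipValue_eq_cubicleCost (by omega), ← pc_zero_left, cubicleCost_pc (by omega) hm (Nat.zero_le _),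
    boxPerim_zero, Nat.add_sub_cancel]

/-- Splitting a `range` sum after inserting a block of `p` equal entries at position `K`. [folklore] -/
private theorem sum_range_insert_block (e : ℕ → ℕ) (F : ℕ → ℕ) (K R p s : ℕ) :
    ∑ k ∈ range (K + R + p),
        F (if k < K then e k else if k < K + p then s else e (k - p)) =
      ∑ k ∈ range (K + R), F (e k) + p * F s := by
  rw [show K + R + p = K + (p + R) by omega, sum_range_add, sum_range_add, sum_range_add]
  have h1 : ∀ k ∈ range K,
      F (if k < K then e k else if k < K + p then s else e (k - p)) = F (e k) :=
    fun k hk => by rw [if_pos (mem_range.1 hk)]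
  have h2 : ∀ j ∈ range p,
      F (if K + j < K then e (K + j) else if K + j < K + p then s else e (K + j - p)) = F s :=
    fun j hj => by
      have := mem_range.1 hj
      rw [if_neg (by omega), if_pos (by omega)]
  have h3 : ∀ j ∈ range R,
      F (if K + (p + j) < K then e (K + (p + j)) else if K + (p + j) < K + p then s
        else e (K + (p + j) - p)) = F (e (K + j)) :=
    fun j _ => by rw [if_neg (by omega), if_neg (by omega), show K + (p + j) - p = K + j by omega]
  rw [sum_congr rfl h1, sum_congr rfl h2, sum_congr rfl h3, sum_const, card_range, smul_eq_mul]
  ring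

/-- **Inserting a block of slices** ([MS20] Lemma 3.4 in value form): if the largest slice of the
cubicle `⟦N⟧^{n+1}` has at least `s` points, then `EIP^{n+1}(N + p·s) ≤ EIP^{n+1}(N) + p·EIP^n(s)`
— insert `p` copies of an `n`-dimensional minimizer of size `s` into the optimal sorted stack of
`N`, in sorted position (the largest slice, hence the vertical cost, is unchanged).
[cite: MaininiSchmidt2020, Lemma 3.4 (proof: M* = D ∪ T*, b(M*) = #S_{d,0}(T*) + b(T*) + b(D))] -/
theorem eipValue_add_mul_le {N s p : ℕ} (hn : 1 ≤ n) (hs : s ≤ cubicleSlices (n + 1) N 0) :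
    eipValue (n + 1) (N + p * s) ≤ eipValue (n + 1) N + p * eipValue n s := by
  rcases Nat.eq_zero_or_pos s with rfl | hs0
  · simp [eipValue_zero_right]
  obtain ⟨D, hD⟩ := exists_isNestedMinimizerFamily hn
  have hanti := cubicleSlices_antitone n N
  have heT : ∀ k, iroot (n + 1) N + 1 ≤ k → cubicleSlices (n + 1) N k = 0 := fun k hk =>
    cubicleSlices_eq_zero_of_lt' hk
  have hsumN := sum_cubicleSlices n N
  have hcostN : 2 * cubicleSlices (n + 1) N 0 +
      ∑ k ∈ range (iroot (n + 1) N + 1), eipValue n (cubicleSlices (n + 1) N k) =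
        eipValue (n + 1) N := by
    rcases Nat.eq_zero_or_pos N with hN | hN
    · subst hN
      simp [eipValue_zero_right]
    · simp_rw [eipValue_eq_cubicleCost hn, eipValue_eq_cubicleCost (show 1 ≤ n + 1 by omega)]
      exact cubicleSlices_cost n hN
  generalize cubicleSlices (n + 1) N = e at hanti heT hsumN hcostN hs
  generalize iroot (n + 1) N + 1 = T at heT hsumN hcostN
  -- `K` = the number of slices with at least `s` points (`1 ≤ K ≤ T`)
  have hex : ∃ k, e k < s := ⟨T, by rw [heT T le_rfl]; exact hs0⟩
  classical
  obtain ⟨K, hKlt, hKmin⟩ : ∃ K, e K < s ∧ ∀ k, k < K → s ≤ e k :=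
    ⟨Nat.find hex, Nat.find_spec hex, fun k hk => not_lt.1 (Nat.find_min hex hk)⟩
  have hK1 : 1 ≤ K := by
    by_contra h
    have h0 : K = 0 := by omega
    rw [h0] at hKlt
    omega
  have hKT : K ≤ T := by
    by_contra h
    have := hKmin T (by omega)
    rw [heT T le_rfl] at this
    omega
  obtain ⟨R, hR⟩ : ∃ R, T = K + R := ⟨T - K, by omega⟩
  subst hR
  -- the profile with the block inserted after the first `K` slices
  obtain ⟨g, hg⟩ : ∃ g : ℕ → ℕ,
      g = fun k => if k < K then e k else if k < K + p then s else e (k - p) := ⟨_, rfl⟩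
  have hg1 : ∀ k, k < K → g k = e k := fun k hk => by
    rw [hg]
    dsimp only
    rw [if_pos hk]
  have hg2 : ∀ k, K ≤ k → k < K + p → g k = s := fun k h1 h2 => by
    rw [hg]
    dsimp only
    rw [if_neg (not_lt.2 h1), if_pos h2]
  have hg3 : ∀ k, K + p ≤ k → g k = e (k - p) := fun k h => by
    rw [hg]
    dsimp only
    rw [if_neg (show ¬ k < K by omega), if_neg (not_lt.2 h)]
  have hg_le : ∀ k, K ≤ k → g k ≤ s := by
    intro k hk
    by_cases h : k < K + p
    · rw [hg2 k hk h]
    · rw [hg3 k (not_lt.1 h)]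
      exact le_of_lt (lt_of_le_of_lt (hanti (show K ≤ k - p by omega)) hKlt)
  have hg_ge : ∀ k, k < K → s ≤ g k := fun k hk => by rw [hg1 k hk]; exact hKmin k hk
  have hg_anti : Antitone g := by
    intro a b hab
    by_cases hb : b < K
    · rw [hg1 b hb, hg1 a (lt_of_le_of_lt hab hb)]
      exact hanti hab
    by_cases ha : a < K
    · exact le_trans (hg_le b (not_lt.1 hb)) (hg_ge a ha)
    by_cases hb' : b < K + p
    · rw [hg2 b (not_lt.1 hb) hb', hg2 a (not_lt.1 ha) (lt_of_le_of_lt hab hb')]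
    · rw [hg3 b (not_lt.1 hb')]
      by_cases ha' : a < K + p
      · rw [hg2 a (not_lt.1 ha) ha']
        exact le_of_lt (lt_of_le_of_lt (hanti (show K ≤ b - p by omega)) hKlt)
      · rw [hg3 a (not_lt.1 ha')]
        exact hanti (show a - p ≤ b - p by omega)
  have hgT : g (K + R + p) = 0 := by
    rw [hg3 _ (by omega), show K + R + p - p = K + R by omega, heT _ le_rfl]
  have hg0 : g 0 = e 0 := hg1 0 (by omega)
  have hsum : ∑ k ∈ range (K + R + p), g k = N + p * s := by
    have h := sum_range_insert_block e id K R p s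
    simp only [id] at h
    rw [hg, h, hsumN]
  have hcost : profileCost n g (K + R + p) = eipValue (n + 1) N + p * eipValue n s := by
    rw [profileCost_def, hg0, hg, sum_range_insert_block e (eipValue n) K R p s]
    omega
  have h := eipValue_succ_le_profileCost hD hg_anti hgT
  rwa [hsum, hcost] at h

/-- **The largest slice of a cubicle is at least the average**: if `N < ℓ^{n+1}` (so `⟦N⟧^{n+1}`
has at most `ℓ` slices) and `ℓ·s ≤ N`, then the bottom slice of `⟦N⟧^{n+1}` has at least `s` points.
[cite: MaininiSchmidt2020, Lemma 3.4 (proof: #D ≤ h·#S_{d,1}(D), so #S_{d,1}(D) ≥ (ℓ−p)ℓ^{d−2})] -/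
theorem le_cubicleSlices_zero {N s ℓ : ℕ} (hℓN : N < ℓ ^ (n + 1)) (hs : ℓ * s ≤ N) :
    s ≤ cubicleSlices (n + 1) N 0 := by
  have hd : 1 ≤ n + 1 := by omega
  have hroot : iroot (n + 1) N + 1 ≤ ℓ := by
    by_contra h
    have h1 : ℓ ≤ iroot (n + 1) N := by omega
    have h2 := Nat.pow_le_pow_left h1 (n + 1)
    have h3 := iroot_pow_le hd N
    omega
  have hmax : ∑ k ∈ range (iroot (n + 1) N + 1), cubicleSlices (n + 1) N k ≤
      (iroot (n + 1) N + 1) * cubicleSlices (n + 1) N 0 := by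
    have := Finset.sum_le_card_nsmul (range (iroot (n + 1) N + 1)) (cubicleSlices (n + 1) N)
      (cubicleSlices (n + 1) N 0) (fun k _ => cubicleSlices_antitone n N (Nat.zero_le k))
    rwa [card_range, smul_eq_mul] at this
  rw [sum_cubicleSlices] at hmax
  rcases Nat.eq_zero_or_pos ℓ with rfl | hℓ
  · rw [zero_pow (by omega)] at hℓN
    omega
  · have : ℓ * s ≤ ℓ * cubicleSlices (n + 1) N 0 :=
      le_trans hs (le_trans hmax (Nat.mul_le_mul_right _ hroot))
    exact Nat.le_of_mul_le_mul_left this hℓ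

/-- **The pseudo-cubic representation of `(ℓ² − q)ℓ^n` in dimension `n + 2`** (`q ≤ ℓ`, `ℓ ≥ 2`):
`(ℓ² − q)ℓ^n = [ℓ−1, n+1]^{n+2} + (ℓ − q)ℓ^n`, so the cubicle is the box `ℓ^{n+1} × (ℓ−1)` with the
`(n+1)`-dimensional cubicle of `(ℓ−q)ℓ^n` on top, and
`2δ_{n+2}((ℓ²−q)ℓ^n) = 2((n+1)(ℓ−1)ℓ^n + ℓ^{n+1}) + 2δ_{n+1}((ℓ−q)ℓ^n)` — the structure of the set
`Q_{ℓ,d,p}` in the proof of [MS20] Lemma 3.5. [cite: MaininiSchmidt2020, Lemma 3.5 (proof: Q_{ℓ,d,p}); AgnarssonLauria2013, eq. (F(n)-rec)] -/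
theorem cubicleCost_box_layer {ℓ q : ℕ} (hℓ : 2 ≤ ℓ) (hq : q ≤ ℓ) (n : ℕ) :
    cubicleCost (n + 2) ((ℓ * ℓ - q) * ℓ ^ n) =
      2 * ((n + 1) * ((ℓ - 1) * ℓ ^ n) + ℓ ^ (n + 1)) + cubicleCost (n + 1) ((ℓ - q) * ℓ ^ n) := by
  have hℓ1 : ℓ - 1 + 1 = ℓ := by omega
  have hpc1 : pc (ℓ - 1) (n + 1) (n + 2) = (ℓ - 1) * ℓ ^ (n + 1) := by
    rw [pc, hℓ1, show n + 2 - (n + 1) = 1 by omega, pow_one, mul_comm]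
  have hpc2 : pc (ℓ - 1) (n + 1) (n + 1) = ℓ ^ (n + 1) := by
    rw [pc_self, hℓ1]
  have hpc3 : pc (ℓ - 1) n (n + 1) = (ℓ - 1) * ℓ ^ n := by
    rw [pc, hℓ1, show n + 1 - n = 1 by omega, pow_one, mul_comm]
  have hsplit : (ℓ * ℓ - q) * ℓ ^ n = pc (ℓ - 1) (n + 1) (n + 2) + (ℓ - q) * ℓ ^ n := by
    rw [hpc1]
    zify [hq, (by omega : 1 ≤ ℓ), (by nlinarith : q ≤ ℓ * ℓ)]
    ring
  have hb : (ℓ - q) * ℓ ^ n ≤ pc (ℓ - 1) (n + 1) (n + 2 - 1) := by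
    rw [show n + 2 - 1 = n + 1 from rfl, hpc2, pow_succ']
    exact Nat.mul_le_mul_right _ (Nat.sub_le ℓ q)
  rw [hsplit, cubicleCost_pc_add (by omega) (by omega) (by omega) hb, show n + 2 - 1 = n + 1 from rfl]
  congr 1
  rw [boxPerim, Nat.add_sub_cancel, show n + 2 - 1 = n + 1 from rfl,
    show n + 2 - (n + 1) = 1 by omega, one_mul, hpc3, hpc2]

/-- `⌊h_{ℓ,d}⌋` is non-increasing in `d` (`ℓ ≥ 1`; `h_{ℓ,d} = ℓ^{2^{1−d}}`). [cite: MaininiSchmidt2020, Definition 3.1] -/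
theorem floor_h_succ_le {ℓ : ℕ} (hℓ : 1 ≤ ℓ) (n : ℕ) :
    ⌊(ℓ : ℝ) ^ ((2 : ℝ) ^ (1 - ((n + 3 : ℕ) : ℝ)))⌋₊ ≤
      ⌊(ℓ : ℝ) ^ ((2 : ℝ) ^ (1 - ((n + 2 : ℕ) : ℝ)))⌋₊ := by
  apply Nat.floor_mono
  apply Real.rpow_le_rpow_of_exponent_le (by exact_mod_cast hℓ)
  apply Real.rpow_le_rpow_of_exponent_le (by norm_num)
  push_cast
  linarith

/-- `p ≤ ⌊h_{ℓ,d}⌋ ⇒ p² ≤ ⌊h_{ℓ,d−1}⌋` (`h_{ℓ,d−1} = h_{ℓ,d}²`, `⌊x⌋² ≤ ⌊x²⌋`).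
[cite: MaininiSchmidt2020, Lemma 3.5 (proof: p² ≤ ⌊h_{ℓ,d}⌋² ≤ ⌊h²_{ℓ,d}⌋ = ⌊h_{ℓ,d−1}⌋)] -/
theorem sq_le_floor_h {ℓ p : ℕ} (n : ℕ)
    (hp : p ≤ ⌊(ℓ : ℝ) ^ ((2 : ℝ) ^ (1 - ((n + 3 : ℕ) : ℝ)))⌋₊) :
    p * p ≤ ⌊(ℓ : ℝ) ^ ((2 : ℝ) ^ (1 - ((n + 2 : ℕ) : ℝ)))⌋₊ := by
  have h0 : (0 : ℝ) ≤ (ℓ : ℝ) ^ ((2 : ℝ) ^ (1 - ((n + 3 : ℕ) : ℝ))) := by positivity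
  have h1 : (p : ℝ) ≤ (ℓ : ℝ) ^ ((2 : ℝ) ^ (1 - ((n + 3 : ℕ) : ℝ))) :=
    le_trans (by exact_mod_cast hp) (Nat.floor_le h0)
  have h2 : ((p * p : ℕ) : ℝ) ≤ ((ℓ : ℝ) ^ ((2 : ℝ) ^ (1 - ((n + 3 : ℕ) : ℝ)))) ^ 2 := by
    rw [Nat.cast_mul, sq]
    exact mul_le_mul h1 h1 (Nat.cast_nonneg p) h0
  have h3 : ((ℓ : ℝ) ^ ((2 : ℝ) ^ (1 - ((n + 3 : ℕ) : ℝ)))) ^ 2 =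
      (ℓ : ℝ) ^ ((2 : ℝ) ^ (1 - ((n + 2 : ℕ) : ℝ))) := by
    rw [← Real.rpow_natCast, ← Real.rpow_mul (Nat.cast_nonneg ℓ)]
    congr 1
    rw [show (((2 : ℕ) : ℝ)) = (2 : ℝ) ^ (1 : ℝ) by norm_num, ← Real.rpow_add (by norm_num)]
    congr 1
    push_cast
    ring
  rw [h3] at h2
  exact Nat.le_floor h2

/-- `p ≤ ⌊h_{ℓ,d}⌋` with `d ≥ 3` and `ℓ ≥ 2` forces `p² < ℓ`.
[cite: MaininiSchmidt2020, Lemma 3.5 (proof: p² ≤ ⌊h_{ℓ,d}⌋² < ℓ for d ≥ 3)] -/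
theorem sq_lt_of_le_floor_h {ℓ p : ℕ} (hℓ : 2 ≤ ℓ) (n : ℕ)
    (hp : p ≤ ⌊(ℓ : ℝ) ^ ((2 : ℝ) ^ (1 - ((n + 3 : ℕ) : ℝ)))⌋₊) : p * p < ℓ := by
  have h := sq_le_floor_h n hp
  have h0 : (0 : ℝ) ≤ (ℓ : ℝ) ^ ((2 : ℝ) ^ (1 - ((n + 2 : ℕ) : ℝ))) := by positivity
  have h1 : ((p * p : ℕ) : ℝ) ≤ (ℓ : ℝ) ^ ((2 : ℝ) ^ (1 - ((n + 2 : ℕ) : ℝ))) :=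
    le_trans (by exact_mod_cast h) (Nat.floor_le h0)
  have h2 : (ℓ : ℝ) ^ ((2 : ℝ) ^ (1 - ((n + 2 : ℕ) : ℝ))) < (ℓ : ℝ) ^ (1 : ℝ) := by
    apply Real.rpow_lt_rpow_of_exponent_lt (by exact_mod_cast (show 1 < ℓ by omega))
    calc (2 : ℝ) ^ (1 - ((n + 2 : ℕ) : ℝ)) ≤ (2 : ℝ) ^ (-1 : ℝ) :=
          Real.rpow_le_rpow_of_exponent_le (by norm_num) (by push_cast; linarith)
      _ < 1 := by rw [Real.rpow_neg_one]; norm_num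
  rw [Real.rpow_one] at h2
  exact_mod_cast h1.trans_lt h2

/-- **[MS20] Lemma 3.5 in value form, every dimension `d = n + 2 ≥ 2`**: for `1 ≤ p < ℓ` with
`p ≤ ⌊h_{ℓ,d}⌋ = ⌊ℓ^{2^{1−d}}⌋`, `EIP^d((ℓ−p)ℓ^{d−1}) = 2(ℓ^{d−1} + (d−1)(ℓ−p)ℓ^{d−2}) = #Θ_d(P_{ℓ,d,p})`.
Induction on `d` following the printed proof: `d = 2` is `MaininiSchmidt2020_lemma35_two`; for
`d ≥ 3`, the box `M = {1..ℓ−p} × {1..ℓ+p} × {1..ℓ}^{d−2}` of `(ℓ+p)·#P_{ℓ,d−1,p}` points has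
`EIP^d(#M) = #Θ_d(M)` because its cubicle is the box `{1..ℓ}^{d−1} × {1..ℓ−1}` topped by the
cubicle of `(ℓ−p²)ℓ^{d−2}` points, an `EIP^{d−1}`-optimal slab by induction (`p² ≤ ⌊h_{ℓ,d−1}⌋`;
this is the rearrangement `M ↦ Q_{ℓ,d,p}`), and Lemma 3.4 (`eipValue_add_mul_le`: removing `p`
slabs `P_{ℓ,d−1,p}` from `M`) gives `EIP^d(#P_{ℓ,d,p}) ≥ #Θ_d(M) − p·#Θ_{d−1}(P_{ℓ,d−1,p}) =
#Θ_d(P_{ℓ,d,p})`. [cite: MaininiSchmidt2020, Lemma 3.5 (with Lemma 3.4 and Definition 3.1)] -/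
theorem eipValue_slab (n : ℕ) : ∀ ℓ p : ℕ, 1 ≤ p → p < ℓ →
    p ≤ ⌊(ℓ : ℝ) ^ ((2 : ℝ) ^ (1 - ((n + 2 : ℕ) : ℝ)))⌋₊ →
      eipValue (n + 2) ((ℓ - p) * ℓ ^ (n + 1)) =
        2 * (ℓ ^ (n + 1) + (n + 1) * ((ℓ - p) * ℓ ^ n)) := by
  induction n with
  | zero =>
    intro ℓ p hp hpℓ hh
    show eipValue 2 ((ℓ - p) * ℓ ^ 1) = 2 * (ℓ ^ 1 + 1 * ((ℓ - p) * ℓ ^ 0))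
    have hmin := MaininiSchmidt2020_lemma35_two ℓ p (by omega) hp hh
    have h := hmin.card_boundaryPairs_eq (card_slabConfig_two ℓ p)
    rw [card_boundaryPairs_slabConfig_two hpℓ] at h
    rw [pow_one, pow_zero, mul_one, one_mul, ← h]
    ring
  | succ n ih =>
    intro ℓ p hp hpℓ hh
    show eipValue (n + 3) ((ℓ - p) * ℓ ^ (n + 2)) =
      2 * (ℓ ^ (n + 2) + (n + 2) * ((ℓ - p) * ℓ ^ (n + 1)))
    have hℓ2 : 2 ≤ ℓ := by omega
    have hh' : p ≤ ⌊(ℓ : ℝ) ^ ((2 : ℝ) ^ (1 - ((n + 2 : ℕ) : ℝ)))⌋₊ :=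
      hh.trans (floor_h_succ_le (by omega) n)
    have hsq : p * p ≤ ⌊(ℓ : ℝ) ^ ((2 : ℝ) ^ (1 - ((n + 2 : ℕ) : ℝ)))⌋₊ := sq_le_floor_h n hh
    have hsqℓ : p * p < ℓ := sq_lt_of_le_floor_h hℓ2 n hh
    -- induction hypothesis: the `(n+2)`-dimensional slabs of deficiency `p` and `p²`
    have hEs : eipValue (n + 2) ((ℓ - p) * ℓ ^ (n + 1)) =
        2 * (ℓ ^ (n + 1) + (n + 1) * ((ℓ - p) * ℓ ^ n)) := ih ℓ p hp hpℓ hh'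
    have hEs2 : eipValue (n + 2) ((ℓ - p * p) * ℓ ^ (n + 1)) =
        2 * (ℓ ^ (n + 1) + (n + 1) * ((ℓ - p * p) * ℓ ^ n)) :=
      ih ℓ (p * p) (Nat.mul_pos hp hp) hsqℓ hsq
    -- the box `M` of `(ℓ+p)(ℓ−p)ℓ^{n+1}` points: its cubicle (the set `Q`)
    have hM : eipValue (n + 3) ((ℓ * ℓ - p * p) * ℓ ^ (n + 1)) =
        2 * ((n + 2) * ((ℓ - 1) * ℓ ^ (n + 1)) + ℓ ^ (n + 2)) +
          2 * (ℓ ^ (n + 1) + (n + 1) * ((ℓ - p * p) * ℓ ^ n)) := by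
      have h := cubicleCost_box_layer hℓ2 hsqℓ.le (n + 1)
      rw [← eipValue_eq_cubicleCost (d := n + 3) (by omega),
        ← eipValue_eq_cubicleCost (d := n + 2) (by omega), hEs2] at h
      exact h
    -- Lemma 3.4: insert `p` slabs `P_{ℓ,n+2,p}` into the cubicle of `#P_{ℓ,n+3,p} = ℓ·#P_{ℓ,n+2,p}`
    have hℓs : (ℓ - p) * ℓ ^ (n + 2) = ℓ * ((ℓ - p) * ℓ ^ (n + 1)) := by ring
    have hsplit : (ℓ * ℓ - p * p) * ℓ ^ (n + 1) =
        ℓ * ((ℓ - p) * ℓ ^ (n + 1)) + p * ((ℓ - p) * ℓ ^ (n + 1)) := by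
      zify [hpℓ.le, (by nlinarith : p * p ≤ ℓ * ℓ)]
      ring
    have hlt : ℓ * ((ℓ - p) * ℓ ^ (n + 1)) < ℓ ^ (n + 2 + 1) := by
      have h1 : (ℓ - p) * ℓ ^ (n + 1) < ℓ * ℓ ^ (n + 1) :=
        Nat.mul_lt_mul_of_pos_right (by omega) (pow_pos (by omega) _)
      calc ℓ * ((ℓ - p) * ℓ ^ (n + 1)) < ℓ * (ℓ * ℓ ^ (n + 1)) :=
            Nat.mul_lt_mul_of_pos_left h1 (by omega)
        _ = ℓ ^ (n + 2 + 1) := by ring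
    have hmax : (ℓ - p) * ℓ ^ (n + 1) ≤ cubicleSlices (n + 2 + 1) (ℓ * ((ℓ - p) * ℓ ^ (n + 1))) 0 :=
      le_cubicleSlices_zero hlt le_rfl
    have hins : eipValue (n + 3) ((ℓ * ℓ - p * p) * ℓ ^ (n + 1)) ≤
        eipValue (n + 3) ((ℓ - p) * ℓ ^ (n + 2)) +
          p * eipValue (n + 2) ((ℓ - p) * ℓ ^ (n + 1)) := by
      rw [hsplit, hℓs]
      exact eipValue_add_mul_le (p := p) (by omega) hmax
    rw [hM, hEs] at hins
    -- upper bound: `ℓ − p` cubes `{1..ℓ}^{n+2}` stacked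
    obtain ⟨D, hD⟩ := exists_isNestedMinimizerFamily (show 1 ≤ n + 2 by omega)
    have hub : eipValue (n + 3) ((ℓ - p) * ℓ ^ (n + 2)) ≤
        2 * ℓ ^ (n + 2) + (ℓ - p) * (2 * ((n + 2) * ℓ ^ (n + 1))) := by
      have h := eipValue_succ_mul_add_le hD (Δ := ℓ ^ (n + 2)) (j := ℓ - p) (x := 0) (by omega)
        (Nat.zero_le _)
      rw [add_zero, eipValue_zero_right, add_zero, eipValue_pow_succ (n + 1) (by omega)] at h
      exact h
    -- arithmetic
    simp only [pow_succ] at hins hub ⊢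
    zify [hpℓ.le, hsqℓ.le, (show 1 ≤ ℓ by omega)] at hins hub ⊢
    apply le_antisymm
    · linarith
    · linarith

/-- **[MS20] Lemma 3.5 in every dimension**: `P_{ℓ,n+2,p}` is an `EIP^{n+2}` minimizer for
`1 ≤ p ≤ ⌊h_{ℓ,n+2}⌋` (empty if `ℓ ≤ p`, which happens only for `ℓ = p = 1`).
[cite: MaininiSchmidt2020, Lemma 3.5] -/
theorem isEIPMinimizer_slabConfig (n ℓ p : ℕ) (hp : 1 ≤ p)
    (hh : p ≤ ⌊(ℓ : ℝ) ^ ((2 : ℝ) ^ (1 - ((n + 2 : ℕ) : ℝ)))⌋₊) :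
    IsEIPMinimizer (slabConfig (n + 2) ℓ p) := by
  rcases Nat.lt_or_ge p ℓ with hpℓ | hge
  · rw [isEIPMinimizer_iff_eipValue, card_slabConfig_succ (n + 1) ℓ p,
      card_boundaryPairs_slabConfig hpℓ (n + 1), eipValue_slab n ℓ p hp hpℓ hh, Nat.add_sub_cancel]
  · rw [slabConfig_succ_eq_empty hge (n + 1)]
    exact isEIPMinimizer_empty

/-- **Mainini–Schmidt 2020, Lemma 3.5, DISCHARGED** (`MaininiSchmidt2020_lemma35_holds`): for every
`d ≥ 2`, `ℓ ≥ 1` and `1 ≤ p ≤ ⌊h_{ℓ,d}⌋ = ⌊ℓ^{2^{1−d}}⌋`, the slab-deficient cube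
`P_{ℓ,d,p} = {1,…,ℓ−p} × {1,…,ℓ}^{d−1}` is an `EIP^d` minimizer. [cite: MaininiSchmidt2020, Lemma 3.5] -/
theorem MaininiSchmidt2020_lemma35_holds : MaininiSchmidt2020_lemma35 := by
  intro d hd ℓ p _ hp hh
  obtain ⟨n, rfl⟩ : ∃ n, d = n + 2 := ⟨d - 2, by omega⟩
  exact isEIPMinimizer_slabConfig n ℓ p hp hh

end SlabValue
/-! ### [MS20] Theorem 1.1 (ii) in every dimension `d ≥ 2`: the sharpness of the fluctuation law -/

section Fluctuation

variable {n : ℕ}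

open scoped symmDiff

/-- `h_{ℓ,d} = ℓ^{2^{1−d}} = u` exactly when `ℓ = u^{2^{d−1}}` (`d = n + 2`).
[cite: MaininiSchmidt2020, Definition 3.1] -/
theorem rpow_h_of_pow (n u : ℕ) :
    (((u ^ 2 ^ (n + 1) : ℕ) : ℝ)) ^ ((2 : ℝ) ^ (1 - ((n + 2 : ℕ) : ℝ))) = u := by
  rw [Nat.cast_pow, ← Real.rpow_natCast (u : ℝ) (2 ^ (n + 1)), ← Real.rpow_mul (Nat.cast_nonneg u)]
  have h : ((2 ^ (n + 1) : ℕ) : ℝ) * (2 : ℝ) ^ (1 - ((n + 2 : ℕ) : ℝ)) = 1 := by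
    rw [Nat.cast_pow, Nat.cast_ofNat, ← Real.rpow_natCast (2 : ℝ) (n + 1),
      ← Real.rpow_add (by norm_num)]
    have : ((n + 1 : ℕ) : ℝ) + (1 - ((n + 2 : ℕ) : ℝ)) = 0 := by
      push_cast
      ring
    rw [this, Real.rpow_zero]
  rw [h, Real.rpow_one]

/-- The fluctuation exponent is non-negative. [cite: MaininiSchmidt2020, Theorem 1.1] -/
theorem maximalFluctuationExponent_nonneg (n : ℕ) : 0 ≤ maximalFluctuationExponent (n + 2) := by
  rw [maximalFluctuationExponent]
  apply div_nonneg _ (by positivity)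
  have h1 : (0 : ℝ) < (2 : ℝ) ^ (1 - ((n + 2 : ℕ) : ℝ)) := Real.rpow_pos_of_pos (by norm_num) _
  have h2 : (1 : ℝ) ≤ ((n + 2 : ℕ) : ℝ) := by exact_mod_cast (show 1 ≤ n + 2 by omega)
  linarith

/-- `2u ≤ u^{2^{n+1}}` for `u ≥ 2`. [folklore] -/
private theorem two_mul_le_pow_two_pow {u : ℕ} (hu : 2 ≤ u) (n : ℕ) : 2 * u ≤ u ^ 2 ^ (n + 1) := by
  have h2 : 2 ≤ 2 ^ (n + 1) := by
    have := Nat.one_le_two_pow (n := n)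
    rw [pow_succ]
    omega
  calc 2 * u ≤ u * u := Nat.mul_le_mul_right u hu
    _ = u ^ 2 := (sq u).symm
    _ ≤ u ^ 2 ^ (n + 1) := Nat.pow_le_pow_right (by omega) h2

/-- `(ℓ^d)^{(d−1+2^{1−d})/d} = ℓ^{d−1}·u` for `ℓ = u^{2^{d−1}}`, `d = n + 2`: the scale
`n^{(d−1+2^{1−d})/d}` of [MS20] Theorem 1.1 at the slab cardinalities, in closed form.
[cite: MaininiSchmidt2020, Theorem 1.1 (ii) (proof via Lemma 3.5)] -/
theorem rpow_maximalFluctuationExponent_pow (n : ℕ) {u : ℕ} (hu : 1 ≤ u) :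
    ((((u ^ 2 ^ (n + 1)) ^ (n + 2) : ℕ) : ℝ)) ^ maximalFluctuationExponent (n + 2) =
      (((u ^ 2 ^ (n + 1)) ^ (n + 1) * u : ℕ) : ℝ) := by
  have hℓpos : (0 : ℝ) < ((u ^ 2 ^ (n + 1) : ℕ) : ℝ) := by
    exact_mod_cast pow_pos (by omega : 0 < u) _
  rw [maximalFluctuationExponent, Nat.cast_mul, Nat.cast_pow (u ^ 2 ^ (n + 1)) (n + 2),
    Nat.cast_pow (u ^ 2 ^ (n + 1)) (n + 1),
    ← Real.rpow_natCast (((u ^ 2 ^ (n + 1) : ℕ) : ℝ)) (n + 2), ← Real.rpow_mul hℓpos.le]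
  have he : ((n + 2 : ℕ) : ℝ) *
      (((((n + 2 : ℕ) : ℝ)) - 1 + (2 : ℝ) ^ (1 - ((n + 2 : ℕ) : ℝ))) / ((n + 2 : ℕ) : ℝ)) =
        ((n + 1 : ℕ) : ℝ) + (2 : ℝ) ^ (1 - ((n + 2 : ℕ) : ℝ)) := by
    have hne : ((n + 2 : ℕ) : ℝ) ≠ 0 := by positivity
    field_simp
    push_cast
    ring
  rw [he, Real.rpow_add hℓpos, Real.rpow_natCast, rpow_h_of_pow n u]

/-- **The translated Wulff cube meets the slab in at most `(ℓ−u)·m^{d−1}` points**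
(`m = ⌊N^{1/d}⌋` the side of `W_N`): a box with a side of length `ℓ − u` intersected with a cube of
side `m`. [cite: MaininiSchmidt2020, Theorem 1.1 (ii) (proof via Lemma 3.5)] -/
theorem card_image_sub_inter_wulffCube_le (ℓ u N : ℕ) (a : Site (n + 2)) :
    #(((slabConfig (n + 2) ℓ u).image fun x => x - a) ∩ wulffCube (n + 2) N) ≤
      (ℓ - u) * latticeRootFloor (n + 2) N ^ (n + 1) := by
  classical
  set m := latticeRootFloor (n + 2) N with hm
  set t : Fin (n + 2) → Finset ℤ := Fin.cons (((Finset.Icc (1 : ℤ) ((ℓ : ℤ) - u)).image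
    fun s => s - a 0)) (fun _ : Fin (n + 1) => Finset.Icc (1 : ℤ) m) with ht
  have hsub : ((slabConfig (n + 2) ℓ u).image fun x => x - a) ∩ wulffCube (n + 2) N ⊆
      Fintype.piFinset t := by
    intro z hz
    rw [mem_inter, mem_image] at hz
    obtain ⟨⟨x, hx, rfl⟩, hzW⟩ := hz
    rw [wulffCube, Fintype.mem_piFinset] at hzW
    rw [mem_slabConfig] at hx
    rw [Fintype.mem_piFinset]
    refine Fin.cases ?_ (fun j => ?_)
    · rw [ht, Fin.cons_zero, Pi.sub_apply, mem_image]
      refine ⟨x 0, ?_, rfl⟩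
      have h0 := hx 0
      rw [Fin.val_zero, if_pos rfl] at h0
      exact mem_Icc.2 h0
    · rw [ht, Fin.cons_succ]
      exact hzW j.succ
  refine (card_le_card hsub).trans ?_
  rw [Fintype.card_piFinset, Fin.prod_univ_succ, ht]
  simp only [Fin.cons_zero, Fin.cons_succ, prod_const, card_univ, Fintype.card_fin]
  rw [card_image_of_injective _ sub_left_injective, Int.card_Icc, Int.card_Icc]
  have h1 : ((ℓ : ℤ) - u + 1 - 1).toNat = ℓ - u := by omega
  have h2 : ((m : ℤ) + 1 - 1).toNat = m := by omega
  rw [h1, h2]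

/-- **The slab misses most of every translated Wulff cube**: for `P = P_{ℓ,n+2,u}` with
`N = #P = (ℓ−u)ℓ^{n+1}` and `m = ⌊N^{1/(n+2)}⌋`,
`#((P − a) △ W_N) ≥ N − (ℓ−u)·m^{n+1}` for every `a ∈ ℤ^{n+2}`.
[cite: MaininiSchmidt2020, Theorem 1.1 (ii) (proof via Lemma 3.5)] -/
theorem le_card_slab_symmDiff_wulffCube (ℓ u : ℕ) (a : Site (n + 2)) :
    (ℓ - u) * ℓ ^ (n + 1) -
        (ℓ - u) * latticeRootFloor (n + 2) ((ℓ - u) * ℓ ^ (n + 1)) ^ (n + 1) ≤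
      #(((slabConfig (n + 2) ℓ u).image fun x => x - a) ∆
        wulffCube (n + 2) ((ℓ - u) * ℓ ^ (n + 1))) := by
  classical
  have hX : #((slabConfig (n + 2) ℓ u).image fun x => x - a) = (ℓ - u) * ℓ ^ (n + 1) := by
    rw [card_image_of_injective _ sub_left_injective, card_slabConfig_succ]
  have h1 : #(((slabConfig (n + 2) ℓ u).image fun x => x - a) \
      wulffCube (n + 2) ((ℓ - u) * ℓ ^ (n + 1))) ≤
        #(((slabConfig (n + 2) ℓ u).image fun x => x - a) ∆
          wulffCube (n + 2) ((ℓ - u) * ℓ ^ (n + 1))) :=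
    card_le_card (by rw [symmDiff_def]; exact subset_union_left)
  have h2 := card_sdiff_add_card_inter ((slabConfig (n + 2) ℓ u).image fun x => x - a)
    (wulffCube (n + 2) ((ℓ - u) * ℓ ^ (n + 1)))
  have h3 := card_image_sub_inter_wulffCube_le ℓ u ((ℓ - u) * ℓ ^ (n + 1)) a
  rw [hX] at h2
  omega

/-- **The Wulff cube is narrower than the slab by `u/d` in every direction**: for
`N = (ℓ−u)ℓ^{d−1}` (`u ≤ ℓ`, `d = n+2`), `d·⌊N^{1/d}⌋ + u ≤ d·ℓ` — Bernoulli's inequality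
`(ℓ − u/d)^d ≥ ℓ^d − uℓ^{d−1} = N`. [cite: MaininiSchmidt2020, Theorem 1.1 (ii) (proof via Lemma 3.5)] -/
theorem latticeRootFloor_slab_le {ℓ u : ℕ} (hℓ : 1 ≤ ℓ) (huℓ : u ≤ ℓ) :
    (n + 2) * latticeRootFloor (n + 2) ((ℓ - u) * ℓ ^ (n + 1)) + u ≤ (n + 2) * ℓ := by
  have hDpos : (0 : ℝ) < ((n + 2 : ℕ) : ℝ) := by positivity
  have hD1 : (1 : ℝ) ≤ ((n + 2 : ℕ) : ℝ) := by exact_mod_cast (by omega : 1 ≤ n + 2)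
  have hℓpos : (0 : ℝ) < ℓ := by exact_mod_cast hℓ
  have huℓ' : (u : ℝ) ≤ ℓ := by exact_mod_cast huℓ
  -- Bernoulli with `α = −u/(dℓ) ≥ −1`
  have hα : -2 ≤ -((u : ℝ) / (((n + 2 : ℕ) : ℝ) * ℓ)) := by
    have : (u : ℝ) / (((n + 2 : ℕ) : ℝ) * ℓ) ≤ 1 := by
      rw [div_le_one (by positivity)]
      nlinarith
    linarith
  have hbern := one_add_mul_le_pow hα (n + 2)
  -- `N ≤ (ℓ − u/d)^d`
  have hB0 : 0 ≤ (ℓ : ℝ) - u / ((n + 2 : ℕ) : ℝ) := by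
    rw [sub_nonneg, div_le_iff₀ hDpos]
    nlinarith
  have hN : ((((ℓ - u) * ℓ ^ (n + 1) : ℕ)) : ℝ) ≤ ((ℓ : ℝ) - u / ((n + 2 : ℕ) : ℝ)) ^ (n + 2) := by
    have hcast : ((((ℓ - u) * ℓ ^ (n + 1) : ℕ)) : ℝ) =
        (ℓ : ℝ) ^ (n + 2) * (1 + ((n + 2 : ℕ) : ℝ) * -((u : ℝ) / (((n + 2 : ℕ) : ℝ) * ℓ))) := by
      rw [Nat.cast_mul, Nat.cast_sub huℓ, Nat.cast_pow]
      field_simp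
      ring
    have hB : (ℓ : ℝ) - u / ((n + 2 : ℕ) : ℝ) = ℓ * (1 + -((u : ℝ) / (((n + 2 : ℕ) : ℝ) * ℓ))) := by
      field_simp
      ring
    rw [hcast, hB, mul_pow]
    exact mul_le_mul_of_nonneg_left hbern (by positivity)
  -- `m ≤ N^{1/d} ≤ ℓ − u/d`
  have hm : ((latticeRootFloor (n + 2) ((ℓ - u) * ℓ ^ (n + 1)) : ℕ) : ℝ) ≤
      (ℓ : ℝ) - u / ((n + 2 : ℕ) : ℝ) := by
    have h1 : ((latticeRootFloor (n + 2) ((ℓ - u) * ℓ ^ (n + 1)) : ℕ) : ℝ) ≤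
        ((((ℓ - u) * ℓ ^ (n + 1) : ℕ)) : ℝ) ^ ((1 : ℝ) / ((n + 2 : ℕ) : ℝ)) := by
      unfold latticeRootFloor
      exact Nat.floor_le (by positivity)
    have h2 : ((((ℓ - u) * ℓ ^ (n + 1) : ℕ)) : ℝ) ^ ((1 : ℝ) / ((n + 2 : ℕ) : ℝ)) ≤
        (((ℓ : ℝ) - u / ((n + 2 : ℕ) : ℝ)) ^ (n + 2)) ^ ((1 : ℝ) / ((n + 2 : ℕ) : ℝ)) :=
      Real.rpow_le_rpow (by positivity) hN (by positivity)
    rw [one_div] at h1 h2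
    rw [Real.pow_rpow_inv_natCast hB0 (by omega)] at h2
    exact h1.trans h2
  have hfin : ((n + 2 : ℕ) : ℝ) * ((latticeRootFloor (n + 2) ((ℓ - u) * ℓ ^ (n + 1)) : ℕ) : ℝ) +
      u ≤ ((n + 2 : ℕ) : ℝ) * ℓ := by
    have := mul_le_mul_of_nonneg_left hm hDpos.le
    rw [mul_sub, mul_div_cancel₀ _ hDpos.ne'] at this
    linarith
  exact_mod_cast hfin

/-- **The deviation estimate**: for `u ≥ 2`, `ℓ = u^{2^{n+1}}`, `P = P_{ℓ,n+2,u}` (`N = #P`),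
`(1/(2(n+2)))·N^{(d−1+2^{1−d})/d} ≤ #((P − a) △ W_N)` for every `a`.  Here
`N^{(d−1+2^{1−d})/d} ≤ ℓ^{d−1}·h_{ℓ,d} = ℓ^{n+1}u`, while the cube `W_N` has side
`m ≤ ℓ − u/(n+2)`, so `P − a` has at least `(ℓ−u)(ℓ−m)ℓ^n ≥ uℓ^{n+1}/(2(n+2))` points outside it.
[cite: MaininiSchmidt2020, Theorem 1.1 (ii) (proof: "This follows directly from Lemma 3.5")] -/
theorem slab_deviation_lower (n : ℕ) {u ℓ : ℕ} (hu : 2 ≤ u) (hℓ : ℓ = u ^ 2 ^ (n + 1))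
    (a : Site (n + 2)) :
    1 / (2 * ((n + 2 : ℕ) : ℝ)) *
        ((((ℓ - u) * ℓ ^ (n + 1) : ℕ)) : ℝ) ^ maximalFluctuationExponent (n + 2) ≤
      (#(((slabConfig (n + 2) ℓ u).image fun x => x - a) ∆
        wulffCube (n + 2) ((ℓ - u) * ℓ ^ (n + 1))) : ℝ) := by
  have hℓu : 2 * u ≤ ℓ := hℓ ▸ two_mul_le_pow_two_pow hu n
  have hℓ1 : 1 ≤ ℓ := by omega
  have huℓ : u ≤ ℓ := by omega
  set N := (ℓ - u) * ℓ ^ (n + 1) with hN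
  set m := latticeRootFloor (n + 2) N with hm
  set dev := #(((slabConfig (n + 2) ℓ u).image fun x => x - a) ∆ wulffCube (n + 2) N) with hdev_def
  have hdev : N - (ℓ - u) * m ^ (n + 1) ≤ dev := le_card_slab_symmDiff_wulffCube ℓ u a
  have hm2 : (n + 2) * m + u ≤ (n + 2) * ℓ := latticeRootFloor_slab_le hℓ1 huℓ
  have hm1 : m ≤ ℓ := by nlinarith
  -- integer arithmetic: `u ℓ^{n+1} ≤ 2(n+2)·dev`
  have hA : (ℓ - u) * m ^ (n + 1) ≤ (ℓ - u) * (m * ℓ ^ n) := by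
    apply Nat.mul_le_mul_left
    rw [pow_succ']
    exact Nat.mul_le_mul_left _ (Nat.pow_le_pow_left hm1 n)
  have hsubN : (ℓ - u) * m ^ (n + 1) ≤ N := by
    rw [hN]
    exact Nat.mul_le_mul_left _ (Nat.pow_le_pow_left hm1 _)
  have hnat : u * ℓ ^ (n + 1) ≤ 2 * (n + 2) * dev := by
    zify [hm1, huℓ, hsubN] at hdev hA hm2 hℓu ⊢
    have hN' : (N : ℤ) = ((ℓ : ℤ) - u) * (ℓ : ℤ) ^ (n + 1) := by
      rw [hN]; push_cast [huℓ]; ring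
    rw [hN'] at hdev
    have hp1 : (0 : ℤ) ≤ ((ℓ : ℤ) - u) * (ℓ : ℤ) ^ n := by
      apply mul_nonneg <;> [linarith; positivity]
    have hp2 : (0 : ℤ) ≤ (u : ℤ) * (ℓ : ℤ) ^ n := by positivity
    have hprod1 := mul_le_mul_of_nonneg_left
      (show (u : ℤ) ≤ (n + 2) * ((ℓ : ℤ) - m) by linarith) hp1
    have hprod2 := mul_le_mul_of_nonneg_left (show (ℓ : ℤ) ≤ 2 * ((ℓ : ℤ) - u) by linarith) hp2
    simp only [pow_succ] at hdev hA ⊢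
    nlinarith [hdev, hA, hprod1, hprod2, hp1, hp2]
  -- the scale `N^{(d−1+2^{1−d})/d} ≤ u ℓ^{n+1}`
  have hNle : N ≤ ℓ ^ (n + 2) := by
    rw [hN, pow_succ' ℓ (n + 1)]
    exact Nat.mul_le_mul_right _ (Nat.sub_le ℓ u)
  have hexp : ((N : ℕ) : ℝ) ^ maximalFluctuationExponent (n + 2) ≤ ((u * ℓ ^ (n + 1) : ℕ) : ℝ) := by
    have h1 : ((N : ℕ) : ℝ) ^ maximalFluctuationExponent (n + 2) ≤
        (((ℓ ^ (n + 2) : ℕ)) : ℝ) ^ maximalFluctuationExponent (n + 2) :=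
      Real.rpow_le_rpow (by positivity) (by exact_mod_cast hNle) (maximalFluctuationExponent_nonneg n)
    have h2 : (((ℓ ^ (n + 2) : ℕ)) : ℝ) ^ maximalFluctuationExponent (n + 2) =
        ((u * ℓ ^ (n + 1) : ℕ) : ℝ) := by
      rw [hℓ, rpow_maximalFluctuationExponent_pow n (by omega), mul_comm]
    rw [h2] at h1
    exact h1
  have hR : ((u * ℓ ^ (n + 1) : ℕ) : ℝ) ≤ 2 * ((n + 2 : ℕ) : ℝ) * (dev : ℝ) := by
    exact_mod_cast hnat
  have hDpos : (0 : ℝ) < 2 * ((n + 2 : ℕ) : ℝ) := by positivity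
  rw [div_mul_eq_mul_div, one_mul, div_le_iff₀ hDpos]
  calc ((N : ℕ) : ℝ) ^ maximalFluctuationExponent (n + 2)
      ≤ ((u * ℓ ^ (n + 1) : ℕ) : ℝ) := hexp
    _ ≤ 2 * ((n + 2 : ℕ) : ℝ) * (dev : ℝ) := hR
    _ = (dev : ℝ) * (2 * ((n + 2 : ℕ) : ℝ)) := by ring

/-- **Mainini–Schmidt 2020, Theorem 1.1 (ii), DISCHARGED** (`MaininiSchmidt2020_thm11_lower_holds`):
for every `d ≥ 2` there is `K_d > 0` (`= 1/(2d)` here) such that for every `ε > 0` infinitely many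
`n` admit an `EIP^d` minimizer `C` with `#((C − a) △ W_n) ≥ (K_d − ε)·n^{(d−1+2^{1−d})/d}` for all
`a ∈ ℤ^d` — the slabs `P_{ℓ,d,u}`, `ℓ = u^{2^{d−1}}` (so `u = h_{ℓ,d}` exactly), minimizers by
Lemma 3.5 (`isEIPMinimizer_slabConfig`), "This follows directly from Lemma 3.5".
[cite: MaininiSchmidt2020, Theorem 1.1 (ii) with Lemma 3.5] -/
theorem MaininiSchmidt2020_thm11_lower_holds : MaininiSchmidt2020_thm11_lower := by
  intro d hd
  obtain ⟨n, rfl⟩ : ∃ n, d = n + 2 := ⟨d - 2, by omega⟩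
  refine ⟨1 / (2 * ((n + 2 : ℕ) : ℝ)), by positivity, fun ε hε => ?_⟩
  refine Set.infinite_of_forall_exists_gt fun b => ?_
  -- parameters: `u = b + 2`, `ℓ = u^{2^{n+1}}`, `n_b = (ℓ − u) ℓ^{n+1}`
  obtain ⟨u, hu⟩ : ∃ u, u = b + 2 := ⟨_, rfl⟩
  obtain ⟨ℓ, hℓ⟩ : ∃ ℓ, ℓ = u ^ 2 ^ (n + 1) := ⟨_, rfl⟩
  have hu2 : 2 ≤ u := by omega
  have hℓu : 2 * u ≤ ℓ := hℓ ▸ two_mul_le_pow_two_pow hu2 n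
  refine ⟨(ℓ - u) * ℓ ^ (n + 1),
    ⟨slabConfig (n + 2) ℓ u, ?_, card_slabConfig_succ _ _ _, fun a => ?_⟩, ?_⟩
  · -- an `EIP^{n+2}` minimizer, by Lemma 3.5 with `u = ⌊h_{ℓ,n+2}⌋`
    refine isEIPMinimizer_slabConfig n ℓ u (by omega) (le_of_eq ?_)
    rw [hℓ, rpow_h_of_pow n u, Nat.floor_natCast]
  · -- the deviation from every translate of the Wulff cube
    have h := slab_deviation_lower n hu2 hℓ a
    have h0 : 0 ≤ ((((ℓ - u) * ℓ ^ (n + 1) : ℕ)) : ℝ) ^ maximalFluctuationExponent (n + 2) := by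
      positivity
    nlinarith
  · -- `n_b > b`
    have h1 : 1 ≤ ℓ ^ (n + 1) := Nat.one_le_pow _ _ (by omega)
    calc b < u := by omega
      _ ≤ ℓ - u := by omega
      _ ≤ (ℓ - u) * ℓ ^ (n + 1) := Nat.le_mul_of_pos_right _ h1

end Fluctuation

end Literature.MathematicalPhysics.StatisticalMechanics
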